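import Summits.QuantumFields.YangMills.Theorems.UnitScaleTiltProp8HalvingQuarterMatrix
import Summits.QuantumFields.YangMills.Theorems.UnitScaleTiltProp8HalvingELJunction
import Summits.QuantumFields.YangMills.Theorems.UnitScaleTiltProp8HalvingSliceDictionary
import HarnessLib

/-!
# Route `UnitScaleTilt`, crux K1 child «MinimiserStabilityRegPr» (stmt-QuantumFields-19200), registered stub V2′ `stub_halvingStep`
# (skeletons v8 5b4e846794b80374 ∕ v10 `BirthV10`) — **THE ℝ → M₂(ℂ) BRIDGE FOR THE (X1) LETTER** (owner ASSIGNMENTS 14 (6) «the componentwise bridge … ≤ 30-line»,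
# named to this seat 05:58Z; under RULING g26-№6 (S5) the chart-`H` of record IS `flatH`, so the bridge is the junction between ★w3-19936 g4's REAL (X1) row
# ✓ p606150∕p606755 `curlCurlSupRow_of_adm22` and the `M₂(ℂ)`-valued (X1) binder `hX1` of ★w6-19200 g0's M2 knit ✓ p607709 `exists_hWq_dressed_cubeSeq_T3`)

Cell `ym3-torus` (HUMAN RULING D-0037, YM ladder rung R3 — continuum SU(2) YM₃ on the torus is a RUNG, not the Clay problem), width seat
`ym-ust-19200-w7` gen 0 (D-0154 (3c)).  `--supports stmt-QuantumFields-19200 --as helper`; def-free, 0 sorry, standard axioms.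

WHAT THIS FILE PROVES (no definition, no sorry):
* §1 ★ **`reading_curlCurl_eq_dcsE_dcE`** (every `P`, real `η`, every `ℝ`-linear reading `φ : M₂(ℂ) →ₗ[ℝ] ℝ`): the reading of the `M₂(ℂ)`-valued flat curl–curl
  `CC_η Z b = ((η:ℂ)²)⁻¹ • Σ_p σ_b(p) • Φ_p(Z)` (the expression of `HalvingDressingLetterT3.exists_linearMap_curlCurl`, `σ_b(p) ∈ {0, ±1}` the incidence of `b` in `∂p`,
  `Φ_p(Z) = Z₁ + Z₂ − Z₃ − Z₄`) IS P2's real `∂*∂` of the read field: `φ(CC_η Z b) = dcsE η⁻¹ (dcE η⁻¹ (toLp (φ∘Z))) b` ([Balaban1984PropagatorsII] (2.19): `∂*` is the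
  `ℓ²`-adjoint of the curl, `B6SectAOperatorsV1.inner_dcsE_left`).
* §2 ★★ **`X1_matrix_of_real`** (d = 3 carrier, any nested family `D`, weights `w 3 ≥ 0`): the REAL (X1) row for `flatH`
  `∀ X t, 0 ≤ t → (∀ c, |X c| ≤ t) → ∀ b, w 3 b·|∂*∂(flatH X)(b)| ≤ B·t` ⟹ the `M₂(ℂ)` (X1) row `∀ X t, 0 ≤ t → (∀ c, ‖X c‖ ≤ t) → ∀ b, w 3 b·‖CC_η(H X) b‖ ≤ B·t`
  (`η = L^{−(K−n)}`) for EVERY `H` acting by the kernel of `flatH` (`H X b = Σ_c (flatH D e_c)(b)•X(c)`) — by duality (`HalvingQuarterMatrix.norm_le_of_forall_reFunctional`: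
  no component loss) and the kernel linearity of readings (`HalvingELJunction.linear_kernel`).
HONEST SCOPE.  Finite-dimensional linear algebra; the real row is ★w3-19936 g4's theorem (hypothesis here).  NOT a claim about the stub, the crux, the rung or the mass gap.

References: T. Bałaban, CMP **96** (1984) 223–250 [Balaban1984PropagatorsII] (2.19) p.226, (2.5) p.224; CMP **102** (1985) 277–309 [Balaban1985Variational] (85)–(89) pp.290–291,
(157)–(158) p.302.
-/

set_option autoImplicit false

noncomputable section

open scoped BigOperators InnerProductSpace Matrix.Norms.L2Operator

namespace Summit.QuantumFields.YangMills.Theorems.HalvingCurlCurlMatrixBridge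

open Literature.MathematicalPhysics.QuantumFieldTheory.Balaban1983to89
open B6SectADomainsV1 (Domains)
open B6SectAOperatorsV1 (BondIdx dcE dcsE dcE_apply inner_eq_sum inner_dcsE_left)
open LatticeFieldCalculus (curl)
open T3ContinuumYM3Torus (T3Family)
open FlatOpsLettersAssembly (flatH)
open HalvingQuarterMatrix (norm_le_of_forall_reFunctional)
open HalvingELJunction (linear_kernel)
open HalvingSliceDictionary (inv_invPow_eq)

/-! ## §1 The reading of the matrix curl–curl is the real `∂*∂` of the reading -/

section Reading

variable {P : Params}

/-- the `b`-component of a vector of `ℓ²(bonds)` as an inner product with the unit vector `e_b`. [folklore] -/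
theorem apply_eq_inner_single (v : EuclideanSpace ℝ (PBond P 0)) (b : PBond P 0) : v b = ⟪v, EuclideanSpace.single b (1 : ℝ)⟫_ℝ := by
  rw [EuclideanSpace.inner_single_right, one_mul, conj_trivial]

/-- the incidence coefficient of `b` in `∂p`, complex versus real: `e_b^ℂ(q) = ↑(e_b^ℝ(q))`. [folklore] -/
theorem single_complex_eq_coe (b q : PBond P 0) :
    (Pi.single b (1 : ℂ) : PBond P 0 → ℂ) q = (((EuclideanSpace.single b (1 : ℝ)) q : ℝ) : ℂ) := by
  rw [show (EuclideanSpace.single b (1 : ℝ)) q = (Pi.single b (1 : ℝ) : PBond P 0 → ℝ) q from by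
    rw [EuclideanSpace.single, PiLp.ofLp_single]]
  by_cases h : q = b
  · subst h; simp
  · simp [h]

/-- ★ **THE READING OF THE MATRIX CURL–CURL IS THE REAL `∂*∂` OF THE READING**: for every `ℝ`-linear `φ : M₂(ℂ) → ℝ`, real `η`, `M₂(ℂ)`-valued bond field `Z` and bond `b`,
`φ(((η:ℂ)²)⁻¹ • Σ_p σ_b(p) • Φ_p(Z)) = (dcsE η⁻¹ (dcE η⁻¹ (φ∘Z)))(b)` — `∂*` the `ℓ²`-adjoint of the curl `∂ = η⁻¹Φ`.
[cite: Balaban1984PropagatorsII, (2.5) p.224, (2.19) p.226; Balaban1985Variational, (157) p.302] -/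
theorem reading_curlCurl_eq_dcsE_dcE (η : ℝ) (φ : Matrix (Fin 2) (Fin 2) ℂ →ₗ[ℝ] ℝ) (Z : PBond P 0 → Matrix (Fin 2) (Fin 2) ℂ) (b : PBond P 0) :
    φ ((((η : ℂ)) ^ 2)⁻¹ • ∑ p : Plaq P 0, ((Pi.single b (1 : ℂ) : PBond P 0 → ℂ) ⟨p.src, p.μ⟩ + (Pi.single b (1 : ℂ) : PBond P 0 → ℂ) ⟨p.src.shift p.μ, p.ν⟩ -
        (Pi.single b (1 : ℂ) : PBond P 0 → ℂ) ⟨p.src.shift p.ν, p.μ⟩ - (Pi.single b (1 : ℂ) : PBond P 0 → ℂ) ⟨p.src, p.ν⟩) •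
        (Z ⟨p.src, p.μ⟩ + Z ⟨p.src.shift p.μ, p.ν⟩ - Z ⟨p.src.shift p.ν, p.μ⟩ - Z ⟨p.src, p.ν⟩)) =
      dcsE η⁻¹ (dcE η⁻¹ (WithLp.toLp 2 (fun b => φ (Z b)))) b := by
  -- right side: `⟪∂(φ∘Z), ∂e_b⟫ = Σ_p (η⁻¹Φ_p(φ∘Z))·(η⁻¹σ_b(p))`
  rw [apply_eq_inner_single, inner_dcsE_left, inner_eq_sum]
  simp only [dcE_apply, curl, smul_eq_mul]
  -- left side: push the reading through the real scalars
  have hcoef : (((η : ℂ)) ^ 2)⁻¹ = (((η ^ 2)⁻¹ : ℝ) : ℂ) := by push_cast; ring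
  rw [hcoef, Complex.coe_smul, LinearMap.map_smul, map_sum, smul_eq_mul, Finset.mul_sum]
  refine Finset.sum_congr rfl fun p _ => ?_
  rw [single_complex_eq_coe, single_complex_eq_coe, single_complex_eq_coe, single_complex_eq_coe]
  rw [show ((((EuclideanSpace.single b (1 : ℝ)) ⟨p.src, p.μ⟩ : ℝ) : ℂ) + (((EuclideanSpace.single b (1 : ℝ)) ⟨p.src.shift p.μ, p.ν⟩ : ℝ) : ℂ) -
      (((EuclideanSpace.single b (1 : ℝ)) ⟨p.src.shift p.ν, p.μ⟩ : ℝ) : ℂ) - (((EuclideanSpace.single b (1 : ℝ)) ⟨p.src, p.ν⟩ : ℝ) : ℂ)) =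
      ((((EuclideanSpace.single b (1 : ℝ)) ⟨p.src, p.μ⟩ + (EuclideanSpace.single b (1 : ℝ)) ⟨p.src.shift p.μ, p.ν⟩ -
        (EuclideanSpace.single b (1 : ℝ)) ⟨p.src.shift p.ν, p.μ⟩ - (EuclideanSpace.single b (1 : ℝ)) ⟨p.src, p.ν⟩ : ℝ) : ℂ)) by push_cast; ring,
    Complex.coe_smul, LinearMap.map_smul, smul_eq_mul, map_sub, map_sub, map_add]
  ring

end Reading

/-! ## §2 The (X1) letter: real row for `flatH` ⟹ matrix row for its kernel extension -/

section Bridge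

variable {F : T3Family} {n K : ℕ}

/-- ★★ **(X1), ℝ → M₂(ℂ)**: the real third-letter row of `flatH` (★w3-19936 g4, `curlCurlSupRow_of_adm22`'s shape: `w 3 b·|∂*∂(flatH X)(b)| ≤ B·t` for real index data
`|X| ≤ t`) implies the `M₂(ℂ)`-valued row in the letters of ★w6-19200 g0's `hX1` — `w 3 b·‖CC_η(H X) b‖ ≤ B·t` for `M₂(ℂ)`-valued index data `‖X‖ ≤ t`, `η = L^{−(K−n)}` — for every
`H` acting through the kernel of `flatH`.  Duality over the readings `M ↦ r·Re(u·f(M))` (no component loss) + `φ(H X b) = flatH (φ∘X) b`.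
[cite: Balaban1985Variational, (85)-(89) pp.290-291, (157)-(158) p.302; Balaban1984PropagatorsII, (2.19) p.226] -/
theorem X1_matrix_of_real (D : Domains (F.P K)) (w : ℕ → PBond (F.P K) 0 → ℝ) (hw3 : ∀ b, 0 ≤ w 3 b) {B : ℝ}
    (hreal : ∀ (X : BondIdx D → ℝ) (t : ℝ), 0 ≤ t → (∀ c, |X c| ≤ t) → ∀ b : PBond (F.P K) 0,
      w 3 b * |(dcsE ((F.L : ℝ) ^ (K - n)) (dcE ((F.L : ℝ) ^ (K - n)) (WithLp.toLp 2 (flatH F n K D X)))) b| ≤ B * t)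
    (H : (BondIdx D → Matrix (Fin 2) (Fin 2) ℂ) → (PBond (F.P K) 0 → Matrix (Fin 2) (Fin 2) ℂ))
    (hH : ∀ (X : BondIdx D → Matrix (Fin 2) (Fin 2) ℂ) (b : PBond (F.P K) 0), H X b = ∑ c, flatH F n K D (Pi.single c 1) b • X c) :
    ∀ (X : BondIdx D → Matrix (Fin 2) (Fin 2) ℂ) (t : ℝ), 0 ≤ t → (∀ c, ‖X c‖ ≤ t) → ∀ b : PBond (F.P K) 0,
      w 3 b * ‖(((((((F.L : ℝ)⁻¹) ^ (K - n)) : ℝ) : ℂ) ^ 2)⁻¹ • ∑ p : Plaq (F.P K) 0,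
        ((Pi.single b (1 : ℂ) : PBond (F.P K) 0 → ℂ) ⟨p.src, p.μ⟩ + (Pi.single b (1 : ℂ) : PBond (F.P K) 0 → ℂ) ⟨p.src.shift p.μ, p.ν⟩ -
          (Pi.single b (1 : ℂ) : PBond (F.P K) 0 → ℂ) ⟨p.src.shift p.ν, p.μ⟩ - (Pi.single b (1 : ℂ) : PBond (F.P K) 0 → ℂ) ⟨p.src, p.ν⟩) •
          (H X ⟨p.src, p.μ⟩ + H X ⟨p.src.shift p.μ, p.ν⟩ - H X ⟨p.src.shift p.ν, p.μ⟩ - H X ⟨p.src, p.ν⟩))‖ ≤ B * t := by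
  intro X t ht hX b
  -- `0 ≤ B·t` (the real row at `X = 0`)
  have hBt : 0 ≤ B * t := by
    have h0 := hreal (fun _ => 0) t ht (fun c => by rw [abs_zero]; exact ht) b
    exact le_trans (mul_nonneg (hw3 b) (abs_nonneg _)) h0
  rcases (hw3 b).lt_or_eq with hpos | hzero
  swap
  · rw [← hzero, zero_mul]; exact hBt
  -- duality: bound every dominated real reading of the matrix by `B·t ∕ w 3 b`
  rw [← le_div_iff₀' hpos]
  refine norm_le_of_forall_reFunctional _ (div_nonneg hBt hpos.le) fun f u r hdom => ?_
  -- the reading `φ(M) = r·Re(u·f(M))` as an `ℝ`-linear map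
  let φ : Matrix (Fin 2) (Fin 2) ℂ →ₗ[ℝ] ℝ :=
    { toFun := fun M => r * (u * f M).re
      map_add' := fun M N => by simp only [map_add, mul_add, Complex.add_re]
      map_smul' := fun s M => by
        simp only [RingHom.id_apply, smul_eq_mul]
        rw [ContinuousLinearMap.map_smul_of_tower, Complex.real_smul, mul_left_comm u, Complex.re_ofReal_mul]
        ring }
  have hφ : ∀ M, φ M = r * (u * f M).re := fun _ => rfl
  rw [← hφ, reading_curlCurl_eq_dcsE_dcE, inv_invPow_eq]
  -- the read field is `flatH` of the read data
  have hread : (fun b' => φ (H X b')) = flatH F n K D (fun c => φ (X c)) := funext fun b' => linear_kernel (flatH F n K D) (hH X) φ b'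
  rw [hread]
  -- the real row on the read data `|φ(X c)| ≤ ‖X c‖ ≤ t`
  have hXφ : ∀ c, |φ (X c)| ≤ t := fun c => (hdom (X c)).trans (hX c)
  have h := hreal (fun c => φ (X c)) t ht hXφ b
  rw [le_div_iff₀' hpos]
  exact (mul_le_mul_of_nonneg_left (le_abs_self _) hpos.le).trans h

end Bridge

end Summit.QuantumFields.YangMills.Theorems.HalvingCurlCurlMatrixBridge

end
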